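import Mathlib.MeasureTheory.Integral.IntervalIntegral.Basic
import Mathlib.MeasureTheory.Group.LIntegral
import Literature.Computability.Cryptography.LWENoise
import Literature.Computability.Cryptography.LWEGaussTheta
import HarnessLib

/-!
# The mass of the discretised Gaussian at zero: reduction to one-dimensional integrals

For Regev's discretised Gaussian `Ψ̄_α = law of ⌊q X⌉ mod q`, `X ∼ N(0, α²/(2π))`
(`LWE.discretizedGaussian`, `LWENoise.lean`), the event `{Ψ̄_α = 0}` contains the disjoint windows
`(k - w, k + w)`, `k ∈ ℤ`, `w = 1/(2q)`.  This file proves the two lower bounds used by the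
estimate `Ψ̄_α(0) ≥ (1 + 1/40)/q` (`LWENoiseGaussianZero.lean`):

* `le_discretizedGaussian_zero_window` — `Ψ̄_α(0) ≥ ∫_{-w/α}^{w/α} exp(-π t²) dt`
  (the central window alone, after the substitution `x = α t`);
* `le_discretizedGaussian_zero_periodic` — `Ψ̄_α(0) ≥ ∫_{(-w, w)} g` for every nonnegative
  integrable `g` dominated on the window by the periodised density
  `∑_{k ∈ ℤ} α⁻¹ exp(-π (y + k)²/α²) = ∑_{n ∈ ℤ} exp(-π α² n²) cos(2π n y)`
  (all windows, translation invariance of Lebesgue measure, Tonelli, and the theta identity of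
  `LWEGaussTheta.lean`).

No auxiliary definitions: the variance is written `Real.toNNReal (α²/(2π))` as in
`discretizedGaussian`, the windows as the intervals `Set.Ioo (k - w) (k + w)`.

## References

* O. Regev, *On lattices, learning with errors, random linear codes, and cryptography*, J. ACM 56
  (2009), §2 (`Ψ_α`, `Ψ̄_α`) [RegevLWE2009].
-/

noncomputable section

open MeasureTheory ProbabilityTheory Real Set
open scoped ENNReal NNReal

namespace Literature.Computability.Cryptography

namespace LWE

/-! ### Regev's density as a Mathlib Gaussian density -/

/-- The variance `α²/(2π)` of Regev's `Ψ_α` as a real number. [cite: RegevLWE2009, §2] -/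
theorem coe_toNNReal_var (α : ℝ) : (Real.toNNReal (α ^ 2 / (2 * π)) : ℝ) = α ^ 2 / (2 * π) :=
  Real.coe_toNNReal _ (by positivity)

/-- The variance is nonzero for `α ≠ 0`. [folklore] -/
theorem toNNReal_var_ne_zero {α : ℝ} (hα : α ≠ 0) : Real.toNNReal (α ^ 2 / (2 * π)) ≠ 0 := by
  intro h
  have := congrArg (fun v : ℝ≥0 => (v : ℝ)) h
  simp only [coe_toNNReal_var, NNReal.coe_zero] at this
  have : α ^ 2 = 0 := by
    field_simp at this
    linarith [this]
  exact hα (pow_eq_zero_iff two_ne_zero |>.1 this)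

/-- The Gaussian density of variance `α²/(2π)` is Regev's `ρ_α/α`:
`gaussianPDFReal 0 (α²/(2π)) x = α⁻¹ exp(-π x²/α²)` (`α > 0`). [cite: RegevLWE2009, §2] -/
theorem gaussianPDFReal_var {α : ℝ} (hα : 0 < α) (x : ℝ) :
    gaussianPDFReal 0 (Real.toNNReal (α ^ 2 / (2 * π))) x = α⁻¹ * Real.exp (-π * x ^ 2 / α ^ 2) := by
  rw [gaussianPDFReal, coe_toNNReal_var]
  have h1 : 2 * π * (α ^ 2 / (2 * π)) = α ^ 2 := by field_simp
  rw [h1, Real.sqrt_sq hα.le]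
  congr 1
  congr 1
  field_simp
  ring

/-! ### The windows around the integers -/

/-- A real within `1/(2q)` of an integer discretises to `0 mod q`: every window lies in the
event `{Ψ̄ = 0}`. [cite: RegevLWE2009, §2] -/
theorem Ioo_int_subset_discretize {q : ℕ} (hq : 0 < q) (k : ℤ) :
    Ioo ((k : ℝ) - 1 / (2 * (q : ℝ))) (k + 1 / (2 * (q : ℝ))) ⊆ discretize q ⁻¹' {0} := by
  intro x hx
  rw [Set.mem_Ioo] at hx
  have hq' : (0 : ℝ) < q := by exact_mod_cast hq
  rw [Set.mem_preimage, Set.mem_singleton_iff, discretize]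
  have hsplit : (q : ℝ) * x = (q : ℝ) * (x - k) + ((q * k : ℤ) : ℝ) := by
    push_cast
    ring
  have hround : round ((q : ℝ) * (x - k)) = 0 := by
    rw [round_eq_zero_iff, Set.mem_Ico]
    have h1 : -(1 / (2 * (q : ℝ))) < x - k := by linarith
    have h2 : x - k < 1 / (2 * (q : ℝ)) := by linarith
    constructor
    · have := mul_lt_mul_of_pos_left h1 hq'
      rw [mul_neg, mul_one_div, show (q : ℝ) / (2 * q) = 1 / 2 by field_simp] at this
      exact this.le
    · have := mul_lt_mul_of_pos_left h2 hq'
      rwa [mul_one_div, show (q : ℝ) / (2 * q) = 1 / 2 by field_simp] at this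
  rw [hsplit, round_add_intCast, hround, zero_add]
  push_cast
  simp

/-- Windows of radius `w ≤ 1/2` around distinct integers are disjoint. [folklore] -/
theorem pairwise_disjoint_Ioo_int {w : ℝ} (hw : w ≤ 1 / 2) :
    Pairwise (Function.onFun Disjoint fun k : ℤ => Ioo ((k : ℝ) - w) (k + w)) := by
  intro k k' hkk'
  rw [Function.onFun, Set.disjoint_left]
  intro x hx hx'
  rw [Set.mem_Ioo] at hx hx'
  have h1 : ((k : ℝ) - k') < 1 := by linarith [hx.1, hx'.2]
  have h2 : -1 < ((k : ℝ) - k') := by linarith [hx.2, hx'.1]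
  have h1' : k - k' < 1 := by exact_mod_cast h1
  have h2' : -1 < k - k' := by exact_mod_cast h2
  exact hkk' (by omega)

/-! ### The measure of the windows -/

/-- The Gaussian measure of one window, as an integral over the central window of the translated
density (translation invariance of Lebesgue measure). [folklore] -/
theorem gaussianReal_Ioo_int {v : ℝ≥0} (hv : v ≠ 0) (w : ℝ) (k : ℤ) :
    gaussianReal 0 v (Ioo ((k : ℝ) - w) (k + w)) =
      ∫⁻ y, (Ioo (-w) w).indicator (fun y => gaussianPDF 0 v (y + k)) y := by
  classical
  rw [gaussianReal_apply _ hv, ← lintegral_indicator measurableSet_Ioo,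
    ← lintegral_add_right_eq_self (μ := volume)
      (fun x => (Ioo ((k : ℝ) - w) (k + w)).indicator (gaussianPDF 0 v) x) (k : ℝ)]
  refine lintegral_congr fun y => ?_
  have hiff : y + k ∈ Ioo ((k : ℝ) - w) (k + w) ↔ y ∈ Ioo (-w) w := by
    simp only [Set.mem_Ioo]
    constructor <;> rintro ⟨h1, h2⟩ <;> constructor <;> linarith
  simp only [Set.indicator_apply, hiff]

/-- Indicators commute with countable sums (pointwise). [folklore] -/
theorem indicator_tsum_apply {ι : Type} (s : Set ℝ) (f : ι → ℝ → ℝ≥0∞) (y : ℝ) :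
    (∑' i, s.indicator (f i) y) = s.indicator (fun y => ∑' i, f i y) y := by
  by_cases hy : y ∈ s
  · simp only [Set.indicator_of_mem hy]
  · simp only [Set.indicator_of_notMem hy, tsum_zero]

/-- **The measure of all windows is the window integral of the periodised density.**
[cite: RegevLWE2009, §2] -/
theorem gaussianReal_iUnion_Ioo_int {α : ℝ} (hα : 0 < α) {w : ℝ} (hw : w ≤ 1 / 2) :
    gaussianReal 0 (Real.toNNReal (α ^ 2 / (2 * π))) (⋃ k : ℤ, Ioo ((k : ℝ) - w) (k + w)) =
      ∫⁻ y in Ioo (-w) w, ENNReal.ofReal (∑' k : ℤ, α⁻¹ * Real.exp (-π * (y + k) ^ 2 / α ^ 2)) := by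
  rw [measure_iUnion (pairwise_disjoint_Ioo_int hw) (fun _ => measurableSet_Ioo)]
  simp_rw [gaussianReal_Ioo_int (toNNReal_var_ne_zero hα.ne') w]
  rw [← lintegral_tsum]
  swap
  · intro k
    exact (((measurable_gaussianPDF 0 _).comp (measurable_add_const (k : ℝ))).indicator
      measurableSet_Ioo).aemeasurable
  simp_rw [indicator_tsum_apply]
  rw [lintegral_indicator measurableSet_Ioo]
  refine setLIntegral_congr_fun measurableSet_Ioo (fun y _ => ?_)
  simp only [gaussianPDF, gaussianPDFReal_var hα]
  rw [ENNReal.ofReal_tsum_of_nonneg (fun k => by positivity)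
    ((summable_exp_shift hα.ne' y).mul_left _)]

/-! ### Lower bound through the periodised density -/

/-- **All windows: `Ψ̄_α(0)` dominates the integral over `(-1/(2q), 1/(2q))` of any nonnegative
integrable minorant of the cosine theta series.** [cite: RegevLWE2009, §2] -/
theorem le_discretizedGaussian_zero_periodic {α : ℝ} (hα : 0 < α) {q : ℕ} [NeZero q] {g : ℝ → ℝ}
    (hg0 : ∀ y ∈ Ioo (-(1 / (2 * (q : ℝ)))) (1 / (2 * (q : ℝ))), 0 ≤ g y)
    (hgi : IntegrableOn g (Ioo (-(1 / (2 * (q : ℝ)))) (1 / (2 * (q : ℝ)))))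
    (hg : ∀ y ∈ Ioo (-(1 / (2 * (q : ℝ)))) (1 / (2 * (q : ℝ))),
      g y ≤ ∑' n : ℤ, Real.exp (-π * α ^ 2 * n ^ 2) * Real.cos (2 * π * n * y)) :
    ENNReal.ofReal (∫ y in Ioo (-(1 / (2 * (q : ℝ)))) (1 / (2 * (q : ℝ))), g y) ≤
      discretizedGaussian q α 0 := by
  have hq : 0 < q := Nat.pos_of_ne_zero (NeZero.ne q)
  have hw : 1 / (2 * (q : ℝ)) ≤ 1 / 2 := by
    have hq1 : (1 : ℝ) ≤ q := by exact_mod_cast hq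
    rw [div_le_div_iff₀ (by positivity) (by positivity)]
    linarith
  rw [discretizedGaussian_apply]
  refine le_trans ?_ (measure_mono (Set.iUnion_subset fun k => Ioo_int_subset_discretize hq k))
  rw [gaussianReal_iUnion_Ioo_int hα hw,
    ofReal_integral_eq_lintegral_ofReal hgi ((ae_restrict_iff' measurableSet_Ioo).2
      (ae_of_all _ hg0))]
  refine setLIntegral_mono' measurableSet_Ioo fun y hy => ENNReal.ofReal_le_ofReal ?_
  rw [tsum_regevDensity_shift_eq_thetaCos hα]
  exact hg y hy

/-! ### Lower bound through the central window -/

/-- **The central window: `Ψ̄_α(0) ≥ ∫_{-1/(2qα)}^{1/(2qα)} exp(-π t²) dt`** (substitute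
`x = α t` in `∫_{-w}^{w} α⁻¹ exp(-π x²/α²) dx`). [cite: RegevLWE2009, §2] -/
theorem le_discretizedGaussian_zero_window {α : ℝ} (hα : 0 < α) {q : ℕ} [NeZero q] :
    ENNReal.ofReal (∫ t in -(1 / (2 * (q : ℝ)) / α)..(1 / (2 * (q : ℝ)) / α), Real.exp (-π * t ^ 2)) ≤
      discretizedGaussian q α 0 := by
  have hq : 0 < q := Nat.pos_of_ne_zero (NeZero.ne q)
  rw [discretizedGaussian_apply]
  have hsub : Ioo (-(1 / (2 * (q : ℝ)))) (1 / (2 * (q : ℝ))) ⊆ discretize q ⁻¹' {0} := by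
    have h := Ioo_int_subset_discretize hq 0
    simpa using h
  refine le_trans ?_ (measure_mono hsub)
  rw [gaussianReal_apply_eq_integral _ (toNNReal_var_ne_zero hα.ne')]
  refine le_of_eq (congrArg ENNReal.ofReal ?_)
  have hw : -(1 / (2 * (q : ℝ))) ≤ 1 / (2 * (q : ℝ)) := by
    have : (0 : ℝ) ≤ 1 / (2 * (q : ℝ)) := by positivity
    linarith
  rw [← integral_Ioc_eq_integral_Ioo, ← intervalIntegral.integral_of_le hw]
  simp_rw [gaussianPDFReal_var hα]
  rw [intervalIntegral.integral_const_mul]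
  have hsubst := intervalIntegral.integral_comp_div (a := -(1 / (2 * (q : ℝ)))) (b := 1 / (2 * (q : ℝ)))
    (fun t => Real.exp (-π * t ^ 2)) hα.ne'
  simp only [div_pow] at hsubst
  rw [show (fun x : ℝ => Real.exp (-π * x ^ 2 / α ^ 2)) = fun x => Real.exp (-π * (x ^ 2 / α ^ 2)) by
    funext x; ring_nf, hsubst, smul_eq_mul, ← mul_assoc, inv_mul_cancel₀ hα.ne', one_mul, neg_div]

end LWE

end Literature.Computability.Cryptography

end
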